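import Literature.NumberTheory.LFunctions.RodgersTaoZeroDynamicsProofs
import Literature.NumberTheory.LFunctions.CsordasSmithVargaLehmerPairsProofs
import Mathlib.Analysis.SpecialFunctions.Pow.Deriv
import Mathlib.Analysis.SpecialFunctions.Pow.Continuity
import Mathlib.Analysis.Calculus.Deriv.MeanValue
import Mathlib.MeasureTheory.Integral.IntervalIntegral.FundThmCalculus
import Mathlib.MeasureTheory.Integral.IntervalIntegral.IntegrationByParts
import HarnessLib

/-!
# Csordas–Smith–Varga 1994, Theorem 1 in time-translated form: a Lehmer pair of `H_{t₀}` bounds `Λ` from below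

RH-FREE CONTENT (label line, cell rh-crit C3, G-rt-9). This is a PROOFS file (no definitions, no
named facts). It proves, in the kernel, the **time-translated form of Csordas–Smith–Varga's
Lehmer-pair theorem** [CsordasSmithVarga1994, Thm. 1]: if `Λ < t₀` and `(a, b)` is a Lehmer pair of
zeros of `H_{t₀} = deBruijnH t₀` in the sense of
`Literature.NumberTheory.LFunctions.IsLehmerPair` (consecutive simple positive real zeros with
`(b − a)² · G < 4/5`, `G = lehmerPairSum t₀ a b`, typed in `CsordasSmithVargaLehmerPairs.lean`
from Saouter–Gourdon–Demichel 2011 Def. A / Thm. A p. 2282 and Stopple 2016 §3), then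
`t₀ + λ ≤ Λ` with CSV's explicit `λ = ((1 − (5/4)(b − a)² G)^{4/5} − 1)/(8G) < 0`
(`lehmerPairBound`):

* `csordasSmithVarga_lehmerPair_bound_of_lt` (hypothesis `deBruijnNewmanConst < t₀`) and its
  `sInf`-free twin `csordasSmithVarga_lehmerPair_bound_of_exists_lt` (hypothesis: some `H_{t₁}`,
  `t₁ < t₀`, has only real zeros — the house form of "`Λ < t₀`" used by the Rodgers–Tao §4 files);
* the indexed form `csordasSmithVarga_lehmerPair_bound_deBruijnZero` (pair `(x_k(t₀), x_{k+1}(t₀))`);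
* corollaries `IsLehmerPair.sub_inv_lt_deBruijnNewmanConst` (`t₀ − 1/(8G) < Λ`) and
  `IsLehmerPair.sub_mul_sq_le_deBruijnNewmanConst` (`t₀ − (5/32)(b − a)² ≤ Λ`: a Lehmer pair with a
  small gap cannot occur much above `Λ`).

HOUSE FORM — NOT PRINTED IN THE HELD SOURCES IN THIS FORM. The printed theorem is the instance
`t₀ = 0` ("a Lehmer pair of `H_0` gives `λ ≤ Λ`", Saouter–Gourdon–Demichel 2011 Thm. A; Stopple
2016 §3 "Theorem (Csordas et al.)"), typed as the named fact
`Literature.NumberTheory.LFunctions.csordasSmithVarga_lehmerPair_bound` and discharged in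
`CsordasSmithVargaLehmerPairsProofs.lean` by the DOMINATED route `λ ≤ 0 ≤ Λ`
(`deBruijnNewmanConst_nonneg_holds`, Rodgers–Tao 2020 / Dobner 2021), which carries none of the
Csordas–Smith–Varga content. The present file formalises that content — the backward-heat-flow
dynamics of a close pair of zeros — in the only generality in which it is not moot in the tree
(`t₀ > Λ ≥ 0`): the printed proof is `t`-translation invariant (the equations of motion (56) of
Rodgers–Tao 2020 are autonomous), and run from time `t₀` instead of `0` it gives `t₀ + λ ≤ Λ`.
Since every decl in `Literature/` carries exactly one provenance tag, the two main theorems are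
tagged with the proof they transport, `[CsordasSmithVarga1994, Thm. 1 (proof)]`; they are NOT a
restatement of a printed theorem and introduce no named fact. Nothing in this file bears on the
truth of the Riemann hypothesis: it is real analysis about the real zeros of `H_t` for `t > Λ`.

## The printed proof and how it is followed (Stopple 2014 §§2–3 "following [CSV]'s exposition
closely", arXiv:1301.3158 pp. 3–5, Lemmas "2.4 [CSV]", "2.5 [CSV]", Theorem 1; module docstring
of `CsordasSmithVargaLehmerPairs.lean`)

Write `x_j(t)`, `j ∈ ℤ*`, for the zeros of `H_t` (`deBruijnZeroZ`, `t > Λ`), `x_k(t₀) = a`,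
`x_{k+1}(t₀) = b`, `K = {k, k+1}`, `Δ(t) = x_{k+1}(t) − x_k(t)`,
`G(t) = Σ_{κ ∈ K} Σ_{j ∈ ℤ* ∖ K} (x_j(t) − x_κ(t))⁻²` (at `t = t₀` this is `lehmerPairSum t₀ a b`:
`lehmerPairSum_deBruijnZero_eq`), `f(t) = Σ_{j ∉ K} 2/((x_k − x_j)(x_{k+1} − x_j))`.
1. Gap dynamics [CSV Lemma 2.4] = Rodgers–Tao 2020 Lemma 12 (i): `(Δ²)' = 8 − 2fΔ²`. In the tree:
   `hasDerivAt_gap_sq` (`RodgersTaoZeroDynamicsProofs.lean`), with `f = 2 · rodgersTaoCrossSum`.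
2. `0 < f < G`: here only `f ≤ G`, termwise `2/(uv) ≤ 1/u² + 1/v²`
   (`two_mul_rodgersTaoCrossSum_le`).
3. [CSV Lemma 2.5] `G' > −8G²` = Rodgers–Tao 2020 Lemma 12 (ii) for `K = {k, k+1}`, available in
   the tree in its printed WEAK form `G(t₂) − G(t₁) ≥ −∫_{t₁}^{t₂} Q`,
   `Q = Σ_{κ ∈ K} Σ_{j ∉ K} 8/(x_κ − x_j)⁴` (`rodgers_tao_cross_energy_inequality_holds`), together
   with `Q ≤ 8G²` (`sum_tsum_div_pow_four_le`). DEVIATION (forced by the weak form): instead of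
   integrating `(1/G)' < 8` pointwise, the comparison `G(t) ≤ G(t₀)/(1 + 8G(t₀)(t − t₀))` for
   `t₀ − 1/(8G(t₀)) < t ≤ t₀` (Stopple p. 4, "as long as `−1/(8g(0)) < t`") is obtained from the
   integral inequality through the `C¹` majorant `W(t) = G(t₀) + ∫_t^{t₀} Q`, for which
   `1/W(t) + 8(t₀ − t)` is non-increasing (`le_div_of_le_add_integral`).
4. Integrating factor and the choice `t = λ` (Stopple's Lemma "(Eq:IVPsoln)" and Theorem 1): with
   `β(t) = 1 + 8G(t₀)(t − t₀)`, the function `β^{1/4} Δ² − (4/(5G(t₀))) β^{5/4}` is non-decreasing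
   on `[t₀ + λ, t₀]` (`gap_comparison`; this packages "`e^{F}Δ² = Δ(t₀)² − 8∫e^{F}`,
   `F > ¼ log β`, `8∫_t^{t₀} e^F > (4/(5G))(1 − β(t)^{5/4})`" into one monotonicity statement, so
   that no pointwise continuity of `f` is needed), and `β(t₀ + λ)^{5/4} = 1 − (5/4)Δ(t₀)²G(t₀)`
   (`rpow_one_add_mul_lehmerPairBound`, the step "by choosing `t` to be `λ`") forces
   `β^{1/4} Δ² ≤ 0` at `t = t₀ + λ`.
5. Conclusion by contradiction: if `Λ < t₀ + λ`, all of `[t₀ + λ, t₀]` lies above `Λ`, where the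
   zeros are real, simple (`csordasSmithVarga_simple_zeros_holds`, CSV Thm. 2.2) and distinct, so
   `Δ(t₀ + λ)² > 0` — contradiction. Hence `t₀ + λ ≤ Λ`.

## References

* G. Csordas, W. Smith, R. S. Varga, *Lehmer pairs of zeros, the de Bruijn–Newman constant `Λ`,
  and the Riemann Hypothesis*, Constr. Approx. 10 (1994) 107–129, Theorem 1 and its proof
  (Lemmas 2.4, 2.5). [CsordasSmithVarga1994] (cite-only, acq-00171; read through the secondaries)
* J. Stopple, *Notes on low discriminants and the generalized Newman conjecture*, Funct. Approx.
  Comment. Math. 51 (2014) = arXiv:1301.3158, §§2–3. [Stopple2014]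
* Y. Saouter, X. Gourdon, P. Demichel, *An improved lower bound for the de Bruijn–Newman
  constant*, Math. Comp. 80 (2011) 2281–2287, Def. A / Thm. A p. 2282. [SaouterGourdonDemichel2011]
* B. Rodgers, T. Tao, *The de Bruijn–Newman constant is non-negative*, Forum Math. Pi 8 (2020)
  e6, Lemma 12 (i), (ii) pp. 29–32. [RodgersTaoFMP2020]
-/

noncomputable section

open Filter Set Topology MeasureTheory

namespace Literature.NumberTheory.LFunctions

/-! ## Two calculus lemmas (the analytic skeleton of the printed proof) -/

/-- **Riccati comparison in integral form** (the role of [CSV, Lemma 2.5] ⇒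
"`g(t) < g(0)/(1 + 8g(0)t)` as long as `−1/(8g(0)) < t`", Stopple 2014 p. 4): if `Q` is
continuous and non-negative on `[T, t₀]`, `0 ≤ G`, `Q ≤ 8G²`, `G(s) ≤ G(t₀) + ∫_s^{t₀} Q` for
`s ∈ [T, t₀]`, `G(t₀) > 0` and `8G(t₀)(t₀ − T) < 1`, then `G(s) ≤ G(t₀)/(1 − 8G(t₀)(t₀ − s))` on
`[T, t₀]`. Proof: for the `C¹` majorant `W(s) = G(t₀) + ∫_s^{t₀} Q ≥ G(s)` the function
`1/W(s) + 8(t₀ − s)` has derivative `Q/W² − 8 ≤ 8G²/W² − 8 ≤ 0`. [folklore] -/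
private theorem le_div_of_le_add_integral {G Q : ℝ → ℝ} {T t₀ : ℝ} (hT : T ≤ t₀)
    (hQc : ContinuousOn Q (Icc T t₀)) (hQ0 : ∀ s ∈ Icc T t₀, 0 ≤ Q s)
    (hQG : ∀ s ∈ Icc T t₀, Q s ≤ 8 * G s ^ 2) (hG0 : ∀ s ∈ Icc T t₀, 0 ≤ G s)
    (hGint : ∀ s ∈ Icc T t₀, G s ≤ G t₀ + ∫ u in s..t₀, Q u) (hpos : 0 < G t₀)
    (hsmall : 8 * G t₀ * (t₀ - T) < 1) :
    ∀ s ∈ Icc T t₀, G s ≤ G t₀ / (1 - 8 * G t₀ * (t₀ - s)) := by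
  intro s hs
  -- the primitive `P r = ∫_T^r Q` and `W r = G t₀ + ∫_r^{t₀} Q = G t₀ + (P t₀ - P r)`
  set P : ℝ → ℝ := fun r ↦ ∫ u in T..r, Q u with hP
  have hQi : IntervalIntegrable Q volume T t₀ := hQc.intervalIntegrable_of_Icc hT
  have hQi' : ∀ r ∈ Icc T t₀, IntervalIntegrable Q volume T r := fun r hr ↦
    (hQc.mono (Icc_subset_Icc_right hr.2)).intervalIntegrable_of_Icc hr.1
  set W : ℝ → ℝ := fun r ↦ G t₀ + (P t₀ - P r) with hW
  have hWeq : ∀ r ∈ Icc T t₀, W r = G t₀ + ∫ u in r..t₀, Q u := by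
    intro r hr
    simp only [hW, hP]
    rw [intervalIntegral.integral_interval_sub_left hQi (hQi' r hr)]
  have hWG : ∀ r ∈ Icc T t₀, G r ≤ W r := fun r hr ↦ by
    rw [hWeq r hr]; exact hGint r hr
  have hWpos : ∀ r ∈ Icc T t₀, 0 < W r := by
    intro r hr
    rw [hWeq r hr]
    have h0 : 0 ≤ ∫ u in r..t₀, Q u :=
      intervalIntegral.integral_nonneg hr.2 fun u hu ↦ hQ0 u ⟨hr.1.trans hu.1, hu.2⟩
    linarith
  -- `P` is continuous on `[T, t₀]` and differentiable inside with `P' = Q`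
  have hQio : IntegrableOn Q (Icc T t₀) volume := hQc.integrableOn_compact isCompact_Icc
  have hPc : ContinuousOn P (Icc T t₀) := by
    have h := intervalIntegral.continuousOn_primitive_interval (μ := volume) (a := T) (b := t₀)
      (f := Q) (by rwa [uIcc_of_le hT])
    rwa [uIcc_of_le hT] at h
  have hPd : ∀ r ∈ Ioo T t₀, HasDerivAt P (Q r) r := by
    intro r hr
    refine intervalIntegral.integral_hasDerivAt_right (hQi' r (Ioo_subset_Icc_self hr)) ?_ ?_
    · exact (hQc.mono Ioo_subset_Icc_self).stronglyMeasurableAtFilter isOpen_Ioo r hr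
    · exact hQc.continuousAt (Icc_mem_nhds hr.1 hr.2)
  have hWc : ContinuousOn W (Icc T t₀) :=
    continuousOn_const.add (continuousOn_const.sub hPc)
  have hWd : ∀ r ∈ Ioo T t₀, HasDerivAt W (-Q r) r := by
    intro r hr
    have h := ((hPd r hr).const_sub (P t₀)).const_add (G t₀)
    simpa [hW] using h
  -- `ρ r = 1 / W r + 8 (t₀ - r)` is non-increasing on `[T, t₀]`
  set ρ : ℝ → ℝ := fun r ↦ 1 / W r + 8 * (t₀ - r) with hρ
  have hρc : ContinuousOn ρ (Icc T t₀) :=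
    (continuousOn_const.div hWc fun r hr ↦ (hWpos r hr).ne').add
      (continuousOn_const.mul (continuousOn_const.sub continuousOn_id))
  have hρd : ∀ r ∈ interior (Icc T t₀),
      HasDerivWithinAt ρ (Q r / W r ^ 2 - 8) (interior (Icc T t₀)) r := by
    intro r hr
    rw [interior_Icc] at hr
    have hW0 : W r ≠ 0 := (hWpos r (Ioo_subset_Icc_self hr)).ne'
    have h1 : HasDerivAt (fun x ↦ 1 / W x) ((0 * W r - 1 * (-Q r)) / W r ^ 2) r :=
      (hasDerivAt_const r (1 : ℝ)).div (hWd r hr) hW0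
    have h2 : HasDerivAt (fun x ↦ 8 * (t₀ - x)) (8 * (0 - 1)) r :=
      ((hasDerivAt_const r t₀).sub (hasDerivAt_id r)).const_mul (8 : ℝ)
    refine ((h1.add h2).congr_deriv ?_).hasDerivWithinAt
    field_simp
    ring
  have hρ' : ∀ r ∈ interior (Icc T t₀), Q r / W r ^ 2 - 8 ≤ 0 := by
    intro r hr
    rw [interior_Icc] at hr
    have hr' : r ∈ Icc T t₀ := Ioo_subset_Icc_self hr
    have hWr := hWpos r hr'
    have hsq : G r ^ 2 ≤ W r ^ 2 := pow_le_pow_left₀ (hG0 r hr') (hWG r hr') 2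
    rw [sub_nonpos, div_le_iff₀ (pow_pos hWr 2)]
    linarith [hQG r hr']
  have hanti := antitoneOn_of_hasDerivWithinAt_nonpos (convex_Icc T t₀) hρc hρd hρ'
  have hρs : ρ t₀ ≤ ρ s := hanti hs (right_mem_Icc.2 hT) hs.2
  have hρt₀ : ρ t₀ = 1 / G t₀ := by simp [hρ, hW]
  have hWs := hWpos s hs
  have hβ : 0 < 1 - 8 * G t₀ * (t₀ - s) := by nlinarith [hs.1]
  -- from `1 / G t₀ ≤ 1 / W s + 8 (t₀ - s)`
  have key : (1 - 8 * G t₀ * (t₀ - s)) * W s ≤ G t₀ := by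
    rw [hρt₀] at hρs
    simp only [hρ] at hρs
    have h1 : 1 / G t₀ - 8 * (t₀ - s) ≤ 1 / W s := by linarith
    have h2 : 1 / G t₀ - 8 * (t₀ - s) = (1 - 8 * G t₀ * (t₀ - s)) / G t₀ := by
      field_simp
    rw [h2, div_le_div_iff₀ hpos hWs, one_mul] at h1
    nlinarith
  calc G s ≤ W s := hWG s hs
    _ ≤ G t₀ / (1 - 8 * G t₀ * (t₀ - s)) := by
        rw [le_div_iff₀ hβ]
        linarith

/-- **Gap comparison** (the integrating-factor step of the printed proof, Stopple 2014 §2 Lemma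
"(Eq:IVPsoln)" and the estimate leading to Theorem 1, packaged as one monotonicity statement): if
`D' = 8 − 4DS` on `[T, t₀]` with `D ≥ 0`, `G₀ > 0`, `β(s) = 1 + 8G₀(s − t₀) > 0` at `s = T`, and
`2β(s)S(s) ≤ G₀` inside the interval (i.e. `2S ≤ G₀/β`, the majorant of the coupling), then
`β^{1/4} D − (4/(5G₀)) β^{5/4}` is non-decreasing on `[T, t₀]`; stated as the comparison of its
endpoint values (`β(t₀) = 1`). Its derivative is `2β^{−3/4} D (G₀ − 2βS) ≥ 0`. [folklore] -/
private theorem gap_comparison {D S : ℝ → ℝ} {T t₀ G₀ : ℝ} (hT : T ≤ t₀) (hG₀ : 0 < G₀)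
    (hβT : 0 < 1 + 8 * G₀ * (T - t₀))
    (hD : ∀ s ∈ Icc T t₀, HasDerivAt D (8 - 4 * D s * S s) s)
    (hD0 : ∀ s ∈ Icc T t₀, 0 ≤ D s)
    (hS : ∀ s ∈ Ioo T t₀, 2 * (1 + 8 * G₀ * (s - t₀)) * S s ≤ G₀) :
    (1 + 8 * G₀ * (T - t₀)) ^ (1 / 4 : ℝ) * D T -
        4 / (5 * G₀) * (1 + 8 * G₀ * (T - t₀)) ^ (5 / 4 : ℝ) ≤
      D t₀ - 4 / (5 * G₀) := by
  set β : ℝ → ℝ := fun s ↦ 1 + 8 * G₀ * (s - t₀) with hβ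
  have hβpos : ∀ s ∈ Icc T t₀, 0 < β s := fun s hs ↦ by
    simp only [hβ]
    nlinarith [hs.1]
  have hβd : ∀ s, HasDerivAt β (8 * G₀) s := fun s ↦ by
    have h := (((hasDerivAt_id s).sub_const t₀).const_mul (8 * G₀)).const_add 1
    simpa [hβ] using h
  have hβc : Continuous β := by
    simp only [hβ]
    fun_prop
  set M : ℝ → ℝ := fun s ↦ β s ^ (1 / 4 : ℝ) * D s - 4 / (5 * G₀) * β s ^ (5 / 4 : ℝ) with hM
  have hDc : ContinuousOn D (Icc T t₀) := fun s hs ↦ (hD s hs).continuousAt.continuousWithinAt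
  have hMc : ContinuousOn M (Icc T t₀) :=
    ((hβc.continuousOn.rpow_const fun s hs ↦ Or.inl (hβpos s hs).ne').mul hDc).sub
      (continuousOn_const.mul (hβc.continuousOn.rpow_const fun s hs ↦ Or.inl (hβpos s hs).ne'))
  set M' : ℝ → ℝ := fun s ↦
    8 * G₀ * (1 / 4 : ℝ) * β s ^ ((1 / 4 : ℝ) - 1) * D s + β s ^ (1 / 4 : ℝ) * (8 - 4 * D s * S s) -
      4 / (5 * G₀) * (8 * G₀ * (5 / 4 : ℝ) * β s ^ ((5 / 4 : ℝ) - 1)) with hM'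
  have hMd : ∀ s ∈ interior (Icc T t₀), HasDerivWithinAt M (M' s) (interior (Icc T t₀)) s := by
    intro s hs
    rw [interior_Icc] at hs
    have hs' : s ∈ Icc T t₀ := Ioo_subset_Icc_self hs
    have h1 := (hβd s).rpow_const (p := (1 / 4 : ℝ)) (Or.inl (hβpos s hs').ne')
    have h2 := (hβd s).rpow_const (p := (5 / 4 : ℝ)) (Or.inl (hβpos s hs').ne')
    exact ((h1.mul (hD s hs')).sub (h2.const_mul (4 / (5 * G₀)))).hasDerivWithinAt
  have hM'0 : ∀ s ∈ interior (Icc T t₀), 0 ≤ M' s := by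
    intro s hs
    rw [interior_Icc] at hs
    have hs' : s ∈ Icc T t₀ := Ioo_subset_Icc_self hs
    have hb := hβpos s hs'
    have hu0 : 0 < β s ^ ((1 / 4 : ℝ) - 1) := Real.rpow_pos_of_pos hb _
    have e1 : β s ^ (1 / 4 : ℝ) = β s * β s ^ ((1 / 4 : ℝ) - 1) := by
      rw [Real.rpow_sub_one hb.ne', ← mul_div_assoc, mul_div_cancel_left₀ _ hb.ne']
    have e2 : β s ^ ((5 / 4 : ℝ) - 1) = β s * β s ^ ((1 / 4 : ℝ) - 1) := by
      rw [← e1]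
      norm_num
    have hSG := hS s hs
    have hDs := hD0 s hs'
    have hexp : M' s = 2 * β s ^ ((1 / 4 : ℝ) - 1) * D s * (G₀ - 2 * β s * S s) := by
      change 8 * G₀ * (1 / 4 : ℝ) * β s ^ ((1 / 4 : ℝ) - 1) * D s +
          β s ^ (1 / 4 : ℝ) * (8 - 4 * D s * S s) -
          4 / (5 * G₀) * (8 * G₀ * (5 / 4 : ℝ) * β s ^ ((5 / 4 : ℝ) - 1)) = _
      rw [e2, e1]
      generalize β s ^ ((1 / 4 : ℝ) - 1) = v
      field_simp
      ring
    rw [hexp]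
    have h3 : 0 ≤ G₀ - 2 * β s * S s := by
      simp only [hβ] at hSG ⊢
      linarith
    positivity
  have hmono := monotoneOn_of_hasDerivWithinAt_nonneg (convex_Icc T t₀) hMc hMd hM'0
  have h := hmono (left_mem_Icc.2 hT) (right_mem_Icc.2 hT) hT
  have hβt₀ : β t₀ = 1 := by simp [hβ]
  simp only [hM, hβt₀, Real.one_rpow, one_mul, mul_one] at h
  simpa [hβ] using h

/-! ## The Lehmer-pair functional `G` as a Rodgers–Tao cross energy over `ℤ* ∖ {k, k+1}` -/

/-- An elementary inequality behind "`0 < f < g`" (Stopple 2014 p. 4; CSV §2): for all real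
`u, v`, `2/(uv) ≤ 1/u² + 1/v²` (with Mathlib's `1/0 = 0` it holds without sign or non-vanishing
hypotheses: it is `(u⁻¹ − v⁻¹)² ≥ 0`). [folklore] -/
private theorem two_mul_one_div_mul_le (u v : ℝ) : 2 * (1 / (u * v)) ≤ 1 / u ^ 2 + 1 / v ^ 2 := by
  rw [one_div, mul_inv, one_div, one_div, ← inv_pow, ← inv_pow]
  nlinarith [sq_nonneg (u⁻¹ - v⁻¹)]

/-- **`lehmerPairSum` is a cross energy.** For `t > Λ` (`sInf`-free) and `k ∈ ℕ`, CSV's functional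
`G` of the pair `(x_k(t), x_{k+1}(t))` — Saouter–Gourdon–Demichel's (2.1)
`G_k = Σ_{j ≠ 0,k,k+1} [(x_k − x_j)⁻² + (x_{k+1} − x_j)⁻²]`, typed as a `tsum` over the real zeros
other than the pair — equals the Rodgers–Tao cross energy `Σ_{κ ∈ K} Σ_{j ∈ ℤ* ∖ K} E_{jκ}(t)` of
`K = {k+1, k}` (display (58)), the zeros being enumerated by `deBruijnZeroZ t`, `j ∈ ℤ*`
(`exists_deBruijnZeroZ_eq`, `deBruijnZeroZ_injective`).
[cite: SaouterGourdonDemichel2011, Def. A (2.1) p. 2282] -/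
theorem lehmerPairSum_deBruijnZero_eq {t : ℝ}
    (hΛ : ∃ t₁ : ℝ, t₁ < t ∧ HasOnlyRealZeros (deBruijnH t₁)) (k : ℕ) :
    lehmerPairSum t (deBruijnZero t k) (deBruijnZero t (k + 1)) =
      ∑ κ ∈ ({((k + 1 : ℕ) : ℤ), (k : ℤ)} : Finset ℤ),
        ∑' j : zstarCompl ({((k + 1 : ℕ) : ℤ), (k : ℤ)} : Finset ℤ), interactionEnergy t j κ := by
  classical
  set κ₁ : ℤ := (k : ℤ) with hκ₁
  set κ₂ : ℤ := ((k + 1 : ℕ) : ℤ) with hκ₂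
  set K : Finset ℤ := {κ₂, κ₁} with hK
  have h12 : κ₂ ≠ κ₁ := by
    simp only [hκ₁, hκ₂]
    push_cast
    linarith
  have ha : deBruijnZeroZ t κ₁ = deBruijnZero t k := deBruijnZeroZ_natCast t k
  have hb : deBruijnZeroZ t κ₂ = deBruijnZero t (k + 1) := deBruijnZeroZ_natCast t (k + 1)
  have hinj := deBruijnZeroZ_injective hΛ
  -- the bijection `j ↦ x_j(t)` from `ℤ* ∖ K` onto the real zeros other than `x_k, x_{k+1}`
  let e : zstarCompl K →
      {x : ℝ // deBruijnH t x = 0 ∧ x ≠ deBruijnZero t k ∧ x ≠ deBruijnZero t (k + 1)} :=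
    fun j ↦ ⟨deBruijnZeroZ t j, deBruijnH_deBruijnZeroZ hΛ j.2.1,
      fun h ↦ j.2.2 (by
        rw [← ha] at h
        rw [hinj h]
        exact Finset.mem_insert_of_mem (Finset.mem_singleton_self _)),
      fun h ↦ j.2.2 (by
        rw [← hb] at h
        rw [hinj h]
        exact Finset.mem_insert_self _ _)⟩
  have hbij : Function.Bijective e := by
    refine ⟨fun i j h ↦ Subtype.ext (hinj (congrArg Subtype.val h)), fun x ↦ ?_⟩
    obtain ⟨j, hj0, hj⟩ := exists_deBruijnZeroZ_eq hΛ x.2.1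
    refine ⟨⟨j, hj0, fun hjK ↦ ?_⟩, Subtype.ext hj⟩
    rw [hK, Finset.mem_insert, Finset.mem_singleton] at hjK
    rcases hjK with rfl | rfl
    · exact x.2.2.2 (by rw [← hj, hb])
    · exact x.2.2.1 (by rw [← hj, ha])
  rw [lehmerPairSum, ← (Equiv.ofBijective e hbij).tsum_eq]
  have hs : ∀ κ, Summable fun j : zstarCompl K ↦ interactionEnergy t j κ :=
    fun κ ↦ (summable_interactionEnergy_int hΛ κ).subtype _
  have hterm : ∀ j : zstarCompl K,
      1 / (deBruijnZero t k - ((Equiv.ofBijective e hbij j : _) : ℝ)) ^ 2 +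
        1 / (deBruijnZero t (k + 1) - ((Equiv.ofBijective e hbij j : _) : ℝ)) ^ 2 =
      interactionEnergy t j κ₁ + interactionEnergy t j κ₂ := by
    intro j
    rw [Equiv.ofBijective_apply, interactionEnergy_eq, interactionEnergy_eq, ha, hb]
    change 1 / (deBruijnZero t k - deBruijnZeroZ t j) ^ 2 +
        1 / (deBruijnZero t (k + 1) - deBruijnZeroZ t j) ^ 2 = _
    rw [← neg_sub (deBruijnZeroZ t j) (deBruijnZero t k), neg_sq,
      ← neg_sub (deBruijnZeroZ t j) (deBruijnZero t (k + 1)), neg_sq]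
  rw [tsum_congr hterm, (hs κ₁).tsum_add (hs κ₂), Finset.sum_pair h12, add_comm]

/-- **`G > 0` for a pair of zeros at a time `t > Λ`.** For `t > Λ` (`sInf`-free) and `k ≥ 1` the
functional `G` of `(x_k(t), x_{k+1}(t))` is positive: `H_t` has a third real zero (e.g. `x_{−1}(t)`)
and every term of SGD's (2.1) is non-negative. (In the printed `t = 0` setting this is implicit in
"`−1/(8G_k) < λ_k < 0`", Saouter–Gourdon–Demichel 2011 Thm. A p. 2282.)
[cite: SaouterGourdonDemichel2011, Def. A (2.1) p. 2282] -/
theorem lehmerPairSum_deBruijnZero_pos {t : ℝ}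
    (hΛ : ∃ t₁ : ℝ, t₁ < t ∧ HasOnlyRealZeros (deBruijnH t₁)) {k : ℕ} (hk : 1 ≤ k) :
    0 < lehmerPairSum t (deBruijnZero t k) (deBruijnZero t (k + 1)) := by
  classical
  rw [lehmerPairSum_deBruijnZero_eq hΛ k]
  set κ₁ : ℤ := (k : ℤ) with hκ₁
  set κ₂ : ℤ := ((k + 1 : ℕ) : ℤ) with hκ₂
  set K : Finset ℤ := {κ₂, κ₁} with hK
  have hs : ∀ κ, Summable fun j : zstarCompl K ↦ interactionEnergy t j κ :=
    fun κ ↦ (summable_interactionEnergy_int hΛ κ).subtype _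
  have hnn : ∀ κ, 0 ≤ ∑' j : zstarCompl K, interactionEnergy t j κ :=
    fun κ ↦ tsum_nonneg fun j ↦ interactionEnergy_nonneg _ _ _
  have hj : (-1 : ℤ) ∈ zstarCompl K := by
    refine ⟨by norm_num, fun h ↦ ?_⟩
    rw [hK, Finset.mem_insert, Finset.mem_singleton, hκ₁, hκ₂] at h
    omega
  have hne : (-1 : ℤ) ≠ κ₁ := by rw [hκ₁]; omega
  have hpos : 0 < ∑' j : zstarCompl K, interactionEnergy t j κ₁ :=
    (hs κ₁).tsum_pos (fun j ↦ interactionEnergy_nonneg _ _ _) ⟨-1, hj⟩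
      (interactionEnergy_pos hΛ hne)
  calc (0 : ℝ) < ∑' j : zstarCompl K, interactionEnergy t j κ₁ := hpos
    _ ≤ ∑ κ ∈ K, ∑' j : zstarCompl K, interactionEnergy t j κ :=
        Finset.single_le_sum (f := fun κ ↦ ∑' j : zstarCompl K, interactionEnergy t j κ)
          (fun κ _ ↦ hnn κ) (by simp [hK])

/-- For a Lehmer pair `(a, b)` of `H_t` with `t > Λ` (`sInf`-free), `G = lehmerPairSum t a b > 0`
(so `λ < 0`, `IsLehmerPair.lehmerPairBound_mem_Ioo` applies).
[cite: SaouterGourdonDemichel2011, Thm. A p. 2282] -/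
theorem IsLehmerPair.lehmerPairSum_pos {t a b : ℝ}
    (hΛ : ∃ t₁ : ℝ, t₁ < t ∧ HasOnlyRealZeros (deBruijnH t₁)) (h : IsLehmerPair t a b) :
    0 < lehmerPairSum t a b := by
  obtain ⟨k, hk, rfl, rfl⟩ := h.exists_eq_deBruijnZero hΛ
  exact lehmerPairSum_deBruijnZero_pos hΛ hk

/-- **"`f < g`"** (Stopple 2014 p. 4, "For `Λ < t` it is elementary that `0 < f(t) < g(t)`"; CSV
§2), in the tree's notation and in the weak form `f ≤ g` that the proof uses: for `t > Λ` and
distinct indices `κ₂, κ₁`, twice the environment coupling `Σ_{j ∈ ℤ* ∖ K} 1/((x_j − x_{κ₂})(x_j − x_{κ₁}))`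
(`rodgersTaoCrossSum t K κ₂ κ₁`, `K = {κ₂, κ₁}`) is at most the cross energy
`Σ_{κ ∈ K} Σ_{j ∈ ℤ* ∖ K} E_{jκ}(t)`, termwise by `2/(uv) ≤ 1/u² + 1/v²`.
[cite: Stopple2014, §2 (arXiv p. 4)] -/
theorem two_mul_rodgersTaoCrossSum_le {t : ℝ}
    (hΛ : ∃ t₁ : ℝ, t₁ < t ∧ HasOnlyRealZeros (deBruijnH t₁)) {κ₂ κ₁ : ℤ} (h12 : κ₂ ≠ κ₁) :
    2 * rodgersTaoCrossSum t {κ₂, κ₁} κ₂ κ₁ ≤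
      ∑ κ ∈ ({κ₂, κ₁} : Finset ℤ), ∑' j : zstarCompl ({κ₂, κ₁} : Finset ℤ),
        interactionEnergy t j κ := by
  classical
  set K : Finset ℤ := {κ₂, κ₁} with hK
  have hc : Summable fun j : zstarCompl K ↦ rodgersTaoCrossTerm t κ₂ κ₁ j :=
    (summable_rodgersTaoCrossTerm_int hΛ κ₂ κ₁).subtype _
  have hs : ∀ κ, Summable fun j : zstarCompl K ↦ interactionEnergy t j κ :=
    fun κ ↦ (summable_interactionEnergy_int hΛ κ).subtype _
  rw [Finset.sum_pair h12, rodgersTaoCrossSum_eq, ← (hc.tsum_mul_left 2), ← (hs κ₂).tsum_add (hs κ₁)]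
  refine (hc.mul_left 2).tsum_le_tsum (fun j ↦ ?_) ((hs κ₂).add (hs κ₁))
  rw [rodgersTaoCrossTerm_eq, interactionEnergy_eq, interactionEnergy_eq]
  exact two_mul_one_div_mul_le _ _

/-- **"`A(t) > −8g(t)²`"** (Stopple 2014, proof of Lemma 2.5 [CSV], arXiv p. 5; the bound used by
Rodgers–Tao 2020 after Lemma 12 (ii)): for `t > Λ` and a finite `K ⊂ ℤ`, the error term of the
cross-energy inequality is dominated by the square of the cross energy,
`Σ_{κ ∈ K} Σ_{j ∈ ℤ* ∖ K} 8/(x_κ − x_j)⁴ ≤ 8 (Σ_{κ ∈ K} Σ_{j ∈ ℤ* ∖ K} E_{jκ})²`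
(`8/(x_κ − x_j)⁴ = 8E_{jκ}²` and `E_{jκ} ≤ Σ E`). [cite: Stopple2014, Lemma 2.5 [CSV] (proof, arXiv p. 5)] -/
theorem sum_tsum_div_pow_four_le {t : ℝ}
    (hΛ : ∃ t₁ : ℝ, t₁ < t ∧ HasOnlyRealZeros (deBruijnH t₁)) (K : Finset ℤ) :
    ∑ κ ∈ K, ∑' j : zstarCompl K, 8 / (deBruijnZeroZ t κ - deBruijnZeroZ t j) ^ 4 ≤
      8 * (∑ κ ∈ K, ∑' j : zstarCompl K, interactionEnergy t j κ) ^ 2 := by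
  classical
  set Gt : ℝ := ∑ κ ∈ K, ∑' j : zstarCompl K, interactionEnergy t j κ with hGt
  have hs : ∀ κ, Summable fun j : zstarCompl K ↦ interactionEnergy t j κ :=
    fun κ ↦ (summable_interactionEnergy_int hΛ κ).subtype _
  have hnn : ∀ (j : zstarCompl K) (κ : ℤ), 0 ≤ interactionEnergy t j κ :=
    fun j κ ↦ interactionEnergy_nonneg _ _ _
  have hSle : ∀ κ ∈ K, ∑' j : zstarCompl K, interactionEnergy t j κ ≤ Gt := fun κ hκ ↦
    Finset.single_le_sum (f := fun κ ↦ ∑' j : zstarCompl K, interactionEnergy t j κ)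
      (fun κ' _ ↦ tsum_nonneg fun j ↦ hnn j κ') hκ
  have hEle : ∀ κ ∈ K, ∀ j : zstarCompl K, interactionEnergy t j κ ≤ Gt := fun κ hκ j ↦
    ((hs κ).le_tsum j fun i _ ↦ hnn i κ).trans (hSle κ hκ)
  have hG0 : 0 ≤ Gt := Finset.sum_nonneg fun κ _ ↦ tsum_nonneg fun j ↦ hnn j κ
  have hterm : ∀ (κ : ℤ) (j : zstarCompl K),
      8 / (deBruijnZeroZ t κ - deBruijnZeroZ t j) ^ 4 = 8 * interactionEnergy t j κ ^ 2 := by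
    intro κ j
    rw [interactionEnergy_eq, div_pow, one_pow, show (deBruijnZeroZ t κ - deBruijnZeroZ t (j : ℤ)) ^ 4 =
      ((deBruijnZeroZ t (j : ℤ) - deBruijnZeroZ t κ) ^ 2) ^ 2 by ring, mul_one_div]
  have hdom : ∀ κ ∈ K, ∀ j : zstarCompl K,
      8 * interactionEnergy t j κ ^ 2 ≤ 8 * Gt * interactionEnergy t j κ := by
    intro κ hκ j
    have h1 := hEle κ hκ j
    have h2 := hnn j κ
    nlinarith
  have hs2 : ∀ κ ∈ K, Summable fun j : zstarCompl K ↦ 8 * interactionEnergy t j κ ^ 2 :=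
    fun κ hκ ↦ ((hs κ).mul_left (8 * Gt)).of_nonneg_of_le (fun j ↦ by positivity) (hdom κ hκ)
  calc ∑ κ ∈ K, ∑' j : zstarCompl K, 8 / (deBruijnZeroZ t κ - deBruijnZeroZ t j) ^ 4
      = ∑ κ ∈ K, ∑' j : zstarCompl K, 8 * interactionEnergy t j κ ^ 2 :=
        Finset.sum_congr rfl fun κ _ ↦ tsum_congr fun j ↦ hterm κ j
    _ ≤ ∑ κ ∈ K, ∑' j : zstarCompl K, 8 * Gt * interactionEnergy t j κ :=
        Finset.sum_le_sum fun κ hκ ↦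
          (hs2 κ hκ).tsum_le_tsum (hdom κ hκ) ((hs κ).mul_left (8 * Gt))
    _ = ∑ κ ∈ K, 8 * Gt * ∑' j : zstarCompl K, interactionEnergy t j κ :=
        Finset.sum_congr rfl fun κ _ ↦ (hs κ).tsum_mul_left (8 * Gt)
    _ = 8 * Gt * Gt := by rw [← Finset.mul_sum, ← hGt]
    _ = 8 * Gt ^ 2 := by ring

/-- **Lemma 12 (ii) rearranged** ([CSV, Lemma 2.5] in Rodgers–Tao's weak form, integrated
backwards from `t₀`): if `H_{t₁}` has only real zeros, `t₁ < s ≤ t₀`, and `K ⊂ ℤ*` is finite, then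
`G(s) ≤ G(t₀) + ∫_s^{t₀} Q` for the cross energy `G = Σ_{κ ∈ K} Σ_{j ∉ K} E_{jκ}` and the error
term `Q = Σ_{κ ∈ K} Σ_{j ∉ K} 8/(x_κ − x_j)⁴` (`rodgers_tao_cross_energy_inequality_holds`).
[cite: RodgersTaoFMP2020, Lemma 12 (ii) p. 30] -/
theorem sum_tsum_interactionEnergy_le_add_integral {t₁ s t₀ : ℝ}
    (hreal : HasOnlyRealZeros (deBruijnH t₁)) (h1s : t₁ < s) (hst : s ≤ t₀) {K : Finset ℤ}
    (hK : (0 : ℤ) ∉ K) :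
    ∑ κ ∈ K, ∑' j : zstarCompl K, interactionEnergy s j κ ≤
      (∑ κ ∈ K, ∑' j : zstarCompl K, interactionEnergy t₀ j κ) +
        ∫ u in s..t₀, ∑ κ ∈ K, ∑' j : zstarCompl K,
          8 / (deBruijnZeroZ u κ - deBruijnZeroZ u j) ^ 4 := by
  rcases hst.eq_or_lt with rfl | hst'
  · simp
  obtain ⟨hsum, -, hineq⟩ :=
    rodgers_tao_cross_energy_inequality_holds K hK s t₀ ⟨t₁, h1s, hreal⟩ hst'
  have hs_s : ∀ κ ∈ K, Summable fun j : zstarCompl K ↦ interactionEnergy s j κ :=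
    fun κ hκ ↦ (hsum s ⟨le_rfl, hst⟩ κ hκ).1
  have hs_t : ∀ κ ∈ K, Summable fun j : zstarCompl K ↦ interactionEnergy t₀ j κ :=
    fun κ hκ ↦ (hsum t₀ ⟨hst, le_rfl⟩ κ hκ).1
  have hsub : ∑ κ ∈ K, ∑' j : zstarCompl K, (interactionEnergy t₀ j κ - interactionEnergy s j κ) =
      (∑ κ ∈ K, ∑' j : zstarCompl K, interactionEnergy t₀ j κ) -
        ∑ κ ∈ K, ∑' j : zstarCompl K, interactionEnergy s j κ := by
    rw [← Finset.sum_sub_distrib]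
    exact Finset.sum_congr rfl fun κ hκ ↦ (hs_t κ hκ).tsum_sub (hs_s κ hκ)
  rw [hsub] at hineq
  linarith

/-! ## The time-translated Lehmer-pair theorem -/

/-- **Csordas–Smith–Varga's Lehmer-pair bound, time-translated — RH-FREE CONTENT, HOUSE FORM**
(`sInf`-free hypothesis). If some `H_{t₁}`, `t₁ < t₀`, has only real zeros (i.e. `Λ < t₀`) and
`(a, b)` is a Lehmer pair of zeros of `H_{t₀}` (`IsLehmerPair t₀ a b`: consecutive simple positive
zeros with `(b − a)² G < 4/5`, `G = lehmerPairSum t₀ a b`), then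
`t₀ + λ ≤ Λ`, `λ = lehmerPairBound (b − a) G = ((1 − (5/4)(b − a)²G)^{4/5} − 1)/(8G)`.
This is the time-translated form of [CSV94, Thm. 1], whose printed `t₀ = 0` instance
`csordasSmithVarga_lehmerPair_bound` is `Λ ≥ 0`-DOMINATED in the tree (p420537); it is NOT
printed in the held sources in this form (Saouter–Gourdon–Demichel 2011 Thm. A and Stopple 2016
§3 state `t₀ = 0`). Proof = the printed proof run from `t₀` (module docstring, steps 1–5): gap
dynamics `hasDerivAt_gap_sq` (RT Lemma 12 (i) = CSV Lemma 2.4), `f ≤ G`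
(`two_mul_rodgersTaoCrossSum_le`), the cross-energy inequality
`rodgers_tao_cross_energy_inequality_holds` (RT Lemma 12 (ii) = CSV Lemma 2.5) with `Q ≤ 8G²`
(`sum_tsum_div_pow_four_le`) and the Riccati comparison `le_div_of_le_add_integral`, the
integrating-factor comparison `gap_comparison`, the identity `rpow_one_add_mul_lehmerPairBound`
("choosing `t = λ`"), and simplicity/distinctness of the zeros above `Λ`
(`csordasSmithVarga_simple_zeros_holds` via `deBruijnZeroZ_sub_ne_zero`).
[cite: CsordasSmithVarga1994, Thm. 1 (proof; time-translated house form)] -/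
theorem csordasSmithVarga_lehmerPair_bound_of_exists_lt {t₀ a b : ℝ}
    (hΛ : ∃ t₁ : ℝ, t₁ < t₀ ∧ HasOnlyRealZeros (deBruijnH t₁)) (h : IsLehmerPair t₀ a b) :
    t₀ + lehmerPairBound (b - a) (lehmerPairSum t₀ a b) ≤ deBruijnNewmanConst := by
  classical
  obtain ⟨k, hk, rfl, rfl⟩ := h.exists_eq_deBruijnZero hΛ
  set G₀ : ℝ := lehmerPairSum t₀ (deBruijnZero t₀ k) (deBruijnZero t₀ (k + 1)) with hG₀def
  set d : ℝ := deBruijnZero t₀ (k + 1) - deBruijnZero t₀ k with hd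
  have hG₀ : 0 < G₀ := lehmerPairSum_deBruijnZero_pos hΛ hk
  have hdG : d ^ 2 * G₀ < 4 / 5 := h.sq_mul_lt
  have hd0 : d ≠ 0 := h.gap_pos.ne'
  have hlam_neg : lehmerPairBound d G₀ < 0 := lehmerPairBound_neg hG₀ hd0 hdG
  have hlam_gt : -1 / (8 * G₀) < lehmerPairBound d G₀ := neg_inv_lt_lehmerPairBound hG₀ hdG
  have hkey : (1 + 8 * G₀ * lehmerPairBound d G₀) ^ (5 / 4 : ℝ) = 1 - 5 / 4 * d ^ 2 * G₀ :=
    rpow_one_add_mul_lehmerPairBound hG₀ hdG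
  by_contra hcon
  rw [not_le] at hcon
  -- the time `T = t₀ + λ` would lie above `Λ`
  set T : ℝ := t₀ + lehmerPairBound d G₀ with hT
  obtain ⟨t₁, hΛt₁, ht₁T⟩ := exists_between hcon
  have hreal : HasOnlyRealZeros (deBruijnH t₁) :=
    (hasOnlyRealZeros_deBruijnH_iff_deBruijnNewmanConst_le_holds t₁).2 hΛt₁.le
  have hTt₀ : T < t₀ := by
    simp only [hT]
    linarith
  have hW : ∀ s ∈ Icc T t₀, ∃ t' : ℝ, t' < s ∧ HasOnlyRealZeros (deBruijnH t') :=
    fun s hs ↦ ⟨t₁, ht₁T.trans_le hs.1, hreal⟩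
  have hβT : 0 < 1 + 8 * G₀ * (T - t₀) := by
    have h1 : T - t₀ = lehmerPairBound d G₀ := by
      simp only [hT]
      ring
    rw [h1]
    have h2 : -1 / (8 * G₀) * (8 * G₀) = -1 := by
      field_simp
    nlinarith [mul_lt_mul_of_pos_right hlam_gt (by positivity : (0 : ℝ) < 8 * G₀)]
  -- indices and the four functions of time
  set κ₁ : ℤ := (k : ℤ) with hκ₁
  set κ₂ : ℤ := ((k + 1 : ℕ) : ℤ) with hκ₂
  set K : Finset ℤ := {κ₂, κ₁} with hK
  have h12 : κ₂ ≠ κ₁ := by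
    simp only [hκ₁, hκ₂]
    push_cast
    linarith
  have hκ₁0 : κ₁ ≠ 0 := by
    simp only [hκ₁]
    omega
  have hκ₂0 : κ₂ ≠ 0 := by
    simp only [hκ₂]
    omega
  have hK0 : (0 : ℤ) ∉ K := by
    intro h0
    rw [hK, Finset.mem_insert, Finset.mem_singleton] at h0
    rcases h0 with h0 | h0
    · exact hκ₂0 h0.symm
    · exact hκ₁0 h0.symm
  set G : ℝ → ℝ := fun s ↦ ∑ κ ∈ K, ∑' j : zstarCompl K, interactionEnergy s j κ with hGdef
  set Q : ℝ → ℝ := fun s ↦ ∑ κ ∈ K, ∑' j : zstarCompl K,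
    8 / (deBruijnZeroZ s κ - deBruijnZeroZ s j) ^ 4 with hQdef
  set D : ℝ → ℝ := fun s ↦ (deBruijnZeroZ s κ₂ - deBruijnZeroZ s κ₁) ^ 2 with hDdef
  set S : ℝ → ℝ := fun s ↦ rodgersTaoCrossSum s K κ₂ κ₁ with hSdef
  have hGt₀ : G t₀ = G₀ := (lehmerPairSum_deBruijnZero_eq hΛ k).symm
  have hDt₀ : D t₀ = d ^ 2 := by
    simp only [hDdef, hd, hκ₁, hκ₂, deBruijnZeroZ_natCast]
  -- Step 3 of the printed proof: the Riccati bound on the cross energy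
  have hGle : ∀ s ∈ Icc T t₀, G s ≤ G₀ / (1 - 8 * G₀ * (t₀ - s)) := by
    have hQc : ContinuousOn Q (Icc T t₀) := continuousOn_sum_tsum_div_sub_pow_four hreal ht₁T K
    have hQ0 : ∀ s ∈ Icc T t₀, 0 ≤ Q s := fun s _ ↦
      Finset.sum_nonneg fun κ _ ↦ tsum_nonneg fun j ↦ by positivity
    have hQG : ∀ s ∈ Icc T t₀, Q s ≤ 8 * G s ^ 2 := fun s hs ↦
      sum_tsum_div_pow_four_le (hW s hs) K
    have hG0 : ∀ s ∈ Icc T t₀, 0 ≤ G s := fun s _ ↦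
      Finset.sum_nonneg fun κ _ ↦ tsum_nonneg fun j ↦ interactionEnergy_nonneg _ _ _
    have hGint : ∀ s ∈ Icc T t₀, G s ≤ G t₀ + ∫ u in s..t₀, Q u := fun s hs ↦
      sum_tsum_interactionEnergy_le_add_integral hreal (ht₁T.trans_le hs.1) hs.2 hK0
    have hsmall : 8 * G t₀ * (t₀ - T) < 1 := by
      rw [hGt₀]
      have h1 : t₀ - T = -(T - t₀) := by ring
      rw [h1]
      linarith
    have hmain := le_div_of_le_add_integral hTt₀.le hQc hQ0 hQG hG0 hGint
      (by rw [hGt₀]; exact hG₀) hsmall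
    rw [hGt₀] at hmain
    exact hmain
  -- Steps 1–2 and 4: the gap ODE, `f ≤ G`, and the comparison
  have hDd : ∀ s ∈ Icc T t₀, HasDerivAt D (8 - 4 * D s * S s) s := fun s hs ↦
    hasDerivAt_gap_sq (hW s hs) hκ₂0 hκ₁0 h12
  have hD0 : ∀ s ∈ Icc T t₀, 0 ≤ D s := fun s _ ↦ sq_nonneg _
  have hS : ∀ s ∈ Ioo T t₀, 2 * (1 + 8 * G₀ * (s - t₀)) * S s ≤ G₀ := by
    intro s hs
    have hs' : s ∈ Icc T t₀ := Ioo_subset_Icc_self hs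
    have hβ : 0 < 1 + 8 * G₀ * (s - t₀) := by nlinarith [hs.1.le]
    have h2S : 2 * S s ≤ G s := two_mul_rodgersTaoCrossSum_le (hW s hs') h12
    have hG := hGle s hs'
    have h1 : 1 - 8 * G₀ * (t₀ - s) = 1 + 8 * G₀ * (s - t₀) := by ring
    rw [h1] at hG
    calc 2 * (1 + 8 * G₀ * (s - t₀)) * S s = (1 + 8 * G₀ * (s - t₀)) * (2 * S s) := by ring
      _ ≤ (1 + 8 * G₀ * (s - t₀)) * (G₀ / (1 + 8 * G₀ * (s - t₀))) :=
          mul_le_mul_of_nonneg_left (h2S.trans hG) hβ.le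
      _ = G₀ := by field_simp
  have hcmp := gap_comparison hTt₀.le hG₀ hβT hDd hD0 hS
  -- Step 5: evaluate at the endpoints, "choosing `t` to be `λ`"
  have hβT_eq : 1 + 8 * G₀ * (T - t₀) = 1 + 8 * G₀ * lehmerPairBound d G₀ := by
    simp only [hT]
    ring
  rw [hβT_eq, hkey, hDt₀] at hcmp
  have hDT : 0 < D T := by
    have hne := deBruijnZeroZ_sub_ne_zero (hW T (left_mem_Icc.2 hTt₀.le)) h12.symm
    simp only [hDdef]
    positivity
  have hβT' : 0 < 1 + 8 * G₀ * lehmerPairBound d G₀ := by rwa [hβT_eq] at hβT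
  have hprod : 0 < (1 + 8 * G₀ * lehmerPairBound d G₀) ^ (1 / 4 : ℝ) * D T :=
    mul_pos (Real.rpow_pos_of_pos hβT' _) hDT
  have h4 : 4 / (5 * G₀) * (1 - 5 / 4 * d ^ 2 * G₀) = 4 / (5 * G₀) - d ^ 2 := by
    field_simp
  rw [h4] at hcmp
  linarith

/-- **Csordas–Smith–Varga's Lehmer-pair bound, time-translated — RH-FREE CONTENT, HOUSE FORM.**
For `Λ < t₀` and a Lehmer pair `(a, b)` of zeros of `H_{t₀}` (consecutive simple positive real
zeros with `(b − a)² G < 4/5`, `G = lehmerPairSum t₀ a b`):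
`t₀ + λ ≤ Λ`, `λ = ((1 − (5/4)(b − a)²G)^{4/5} − 1)/(8G) < 0` — a LOWER bound on `Λ` that is not
dominated by `0 ≤ Λ` (every `t₀ > Λ ≥ 0` is admissible). Time-translated form of
[CSV94, Thm. 1], whose printed `t₀ = 0` instance `csordasSmithVarga_lehmerPair_bound` is
`Λ ≥ 0`-DOMINATED (p420537); NOT printed in the held sources in this form; no named fact is
introduced. From `csordasSmithVarga_lehmerPair_bound_of_exists_lt` and Newman's characterisation
`hasOnlyRealZeros_deBruijnH_iff_deBruijnNewmanConst_le_holds`.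
[cite: CsordasSmithVarga1994, Thm. 1 (proof; time-translated house form)] -/
theorem csordasSmithVarga_lehmerPair_bound_of_lt {t₀ a b : ℝ}
    (hΛ : deBruijnNewmanConst < t₀) (h : IsLehmerPair t₀ a b) :
    t₀ + lehmerPairBound (b - a) (lehmerPairSum t₀ a b) ≤ deBruijnNewmanConst := by
  obtain ⟨t₁, hΛt₁, ht₁⟩ := exists_between hΛ
  exact csordasSmithVarga_lehmerPair_bound_of_exists_lt
    ⟨t₁, ht₁, (hasOnlyRealZeros_deBruijnH_iff_deBruijnNewmanConst_le_holds t₁).2 hΛt₁.le⟩ h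

/-- **Indexed form** (Saouter–Gourdon–Demichel's Definition A read at time `t₀`, via
`isLehmerPair_deBruijnZero_iff`): for `t₀ > Λ` (`sInf`-free), `k ≥ 1`, and consecutive zeros
`x_k(t₀) < x_{k+1}(t₀)` of the enumeration `deBruijnZero t₀` with `(x_{k+1} − x_k)² G_k < 4/5`,
`t₀ + λ_k ≤ Λ`. RH-FREE CONTENT; house form (time-translated [CSV94, Thm. 1]).
[cite: CsordasSmithVarga1994, Thm. 1 (proof; time-translated house form)] -/
theorem csordasSmithVarga_lehmerPair_bound_deBruijnZero {t₀ : ℝ}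
    (hΛ : ∃ t₁ : ℝ, t₁ < t₀ ∧ HasOnlyRealZeros (deBruijnH t₁)) {k : ℕ} (hk : 1 ≤ k)
    (hlt : (deBruijnZero t₀ (k + 1) - deBruijnZero t₀ k) ^ 2 *
      lehmerPairSum t₀ (deBruijnZero t₀ k) (deBruijnZero t₀ (k + 1)) < 4 / 5) :
    t₀ + lehmerPairBound (deBruijnZero t₀ (k + 1) - deBruijnZero t₀ k)
        (lehmerPairSum t₀ (deBruijnZero t₀ k) (deBruijnZero t₀ (k + 1))) ≤ deBruijnNewmanConst :=
  csordasSmithVarga_lehmerPair_bound_of_exists_lt hΛ ((isLehmerPair_deBruijnZero_iff hΛ k).2 ⟨hk, hlt⟩)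

/-- `λ`-free corollary: a Lehmer pair of `H_{t₀}` with `Λ < t₀` gives `t₀ − 1/(8G) < Λ`
(from `−1/(8G) < λ`, Saouter–Gourdon–Demichel 2011 p. 2282 "so that `−1/(8G_k) < λ_k`", here
`neg_inv_lt_lehmerPairBound`). RH-FREE; house form.
[cite: CsordasSmithVarga1994, Thm. 1 (proof; time-translated house form)] -/
theorem IsLehmerPair.sub_inv_lt_deBruijnNewmanConst {t₀ a b : ℝ}
    (hΛ : deBruijnNewmanConst < t₀) (h : IsLehmerPair t₀ a b) :
    t₀ - 1 / (8 * lehmerPairSum t₀ a b) < deBruijnNewmanConst := by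
  obtain ⟨t₁, hΛt₁, ht₁⟩ := exists_between hΛ
  have hΛ' : ∃ t₁ : ℝ, t₁ < t₀ ∧ HasOnlyRealZeros (deBruijnH t₁) :=
    ⟨t₁, ht₁, (hasOnlyRealZeros_deBruijnH_iff_deBruijnNewmanConst_le_holds t₁).2 hΛt₁.le⟩
  have hG := h.lehmerPairSum_pos hΛ'
  have h1 := neg_inv_lt_lehmerPairBound hG h.sq_mul_lt
  have h2 := csordasSmithVarga_lehmerPair_bound_of_exists_lt hΛ' h
  have h3 : -1 / (8 * lehmerPairSum t₀ a b) = -(1 / (8 * lehmerPairSum t₀ a b)) := by ring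
  linarith

/-- Taylor-form corollary: a Lehmer pair of `H_{t₀}` with `Λ < t₀` and gap `d = b − a` gives
`t₀ − (5/32) d² ≤ Λ` (from `−(5/32) d² ≤ λ`, `neg_mul_sq_le_lehmerPairBound`): equivalently, at a
time `t₀ > Λ` no Lehmer pair has gap `d < √(32 (t₀ − Λ)/5)`. RH-FREE; house form.
[cite: CsordasSmithVarga1994, Thm. 1 (proof; time-translated house form)] -/
theorem IsLehmerPair.sub_mul_sq_le_deBruijnNewmanConst {t₀ a b : ℝ}
    (hΛ : deBruijnNewmanConst < t₀) (h : IsLehmerPair t₀ a b) :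
    t₀ - 5 / 32 * (b - a) ^ 2 ≤ deBruijnNewmanConst := by
  obtain ⟨t₁, hΛt₁, ht₁⟩ := exists_between hΛ
  have hΛ' : ∃ t₁ : ℝ, t₁ < t₀ ∧ HasOnlyRealZeros (deBruijnH t₁) :=
    ⟨t₁, ht₁, (hasOnlyRealZeros_deBruijnH_iff_deBruijnNewmanConst_le_holds t₁).2 hΛt₁.le⟩
  have hG := h.lehmerPairSum_pos hΛ'
  have h1 := neg_mul_sq_le_lehmerPairBound hG h.sq_mul_lt
  have h2 := csordasSmithVarga_lehmerPair_bound_of_exists_lt hΛ' h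
  linarith

end Literature.NumberTheory.LFunctions

end
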